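import Literature.AlgebraicGeometry.Frobenioids.ArchimedeanProp35iCounterexample
import HarnessLib

/-!
# Frobenioids II, Proposition 3.5 (iii): a COUNTEREXAMPLE over the base `D := D₀`, `D → D₀` the
# Galois-collapsing functor (abc-iut cell, layer L1; refutation of the typed instance
# `ArchFrd.Prop35iii_N` for this base — finding P35iii-F1, the (iii)-twin of P35i-F1)

Mochizuki, *The geometry of Frobenioids II: poly-Frobenioids*, Kyushu J. Math. **62** (2008) 401–460,
§3, Proposition 3.5 (iii), kurims p. 34 (proof p. 35 ll. 28–40) [cite: MochizukiFrdII2008, Prop 3.5 (iii) p.34]: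
"The categories `N`, `R` are of RC-iso-subanchor type" — for the angloids `N = A^lin ⊆ C = C₀ ×_{D₀} D`,
`R = R₀ ×_{D₀} D` of Example 3.3 (iii)/(iv) over ANY connected, totally epimorphic `D` with a functor
`D → D₀`, `D` of RC-iso-subanchor type ([FrdII] Def. 3.1 (v)).

PROVED here: the typed instance `ArchFrd.Prop35iii_N π` (abc-iut-L1-t9, `ArchimedeanTheoremsInstances.lean`,
schema `ArchFrd.Prop35iii`) is FALSE for the base `D := D₀` equipped with the Galois-COLLAPSING functor
`π := ArchFrd.D0.collapse : D₀ → D₀` of `ArchimedeanProp35iCounterexample.lean` (identity on objects and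
on `Spec ℂ → Spec ℝ`, complex conjugation ↦ identity): `not_prop35iii_N_collapse`.  `D₀` is connected,
totally epimorphic and of RC-iso-subanchor type for this functor (`D0.isOfRCIsoSubanchorType_collapse`,
seat abc-iut-w4-d100), but the object `A := (Spec ℝ, unit isotropic region)` of `N` over `Spec ℝ` is NOT
an RC-iso-subanchor of `N` (`not_isRCIsoSubanchor_unitObj_N`): for EVERY object `B` of `N`, every subgroup
`Γ ⊆ Aut_N(B)` and every arrow `f : B → A`, if `B` is an RC-subanchor then `B` is complex (an
RC-subanchor maps to a complex RC-anchor, and only complex objects map to complex objects), every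
`γ ∈ Γ` lies over an endomorphism of `Spec ℂ`, which `π` sends to the identity, so (compatibility
square of arrows of `C₀ ×_{D₀} D₀`) the `C₀`-component of `γ` has `Base = id`; hence the arrow
`ψ := ((Base f₀, deg f₀, i · c_{f₀}), f_D) : B → A` — the same data as `f` with scalar multiplied by `i`,
an arrow of `C` because `B` is complex and the region of `A` is isotropic, an ISOMETRY because `|i| = 1`
and LINEAR because `f` is — is `Γ`-invariant exactly as `f` is, while a factorisation `ψ = f ≫ ψ'`
in `N` would need an endomorphism `ψ'` of the REAL object `A` with scalar `i ∉ ℝ^×`.  So `f` is not a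
categorical quotient of `B` by `Γ` ([FrdI] §0 p. 18), let alone a mono-minimal one.

WHERE PRINT SLIPS (p. 35 ll. 28–31): "(iii) … follows by the same scheme, using (i)" — and (i) as
printed needs an element of `G_D` mapping to complex conjugation in `Aut_{D₀}(Spec ℂ)` whenever `B_D`
is complex over a real `A_D` (finding P35i-F1, `ArchFrd.not_prop35i_C_collapse`; repaired statement
`ArchFrd.Prop35iR` under Galois saturation, `ArchimedeanQuotientLifting.lean`).  For (iii) the slip is
sharper than for (i): over a base whose functor to `D₀` kills the automorphisms of the complex objects,
a real object of `N` admits NO presentation as a mono-minimal categorical quotient of an RC-subanchor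
AT ALL, whatever quotient data one starts from in `D` — so the repaired (iii) needs the saturation
hypothesis on the BASE FUNCTOR (every automorphism of `Spec ℂ` over `Spec π(B_D) → Spec π(A_D)` lifts to
`Aut_D(B_D)` over `A_D` for the quotient data witnessing the RC-iso-subanchor type of `D`), which holds
in the arithmetic situation the paper has in mind (connected temperoids of number fields at archimedean
primes).  NOT touched here: the twin instance `Prop35iii_R` for the RIGIDIFIED angloid `R = R₀ ×_{D₀} D`
— there the rigidification `X → A` pins the scalar of every arrow, so the phase twist `i · f` used below
is not an arrow of `R` and this mechanism does not apply (no claim either way is made about `R`).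
FINDING about one printed item; no side is taken on [IUTchIII] Cor. 3.12; typed ≠ proved except where a
`theorem` says so.  Seat abc-iut-w4-d027 (gen 2), sub-DAG row P35-L06 of `SUBDAG-FrdII-Thm36-Prop35.md`.
-/

namespace Literature.AlgebraicGeometry.Frobenioids

open CategoryTheory
open scoped Pointwise

noncomputable section

namespace ArchFrd

universe v u

section General

variable {D : Type u} [Category.{v} D] (π : D ⥤ D0)

/-- Composition in `N = A^lin ⊆ A ⊆ C` is composition in `C` on underlying arrows (both wide
subcategories). [cite: MochizukiFrdII2008, Ex 3.3 (iii) p.29] -/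
theorem N.hom_hom_comp {X Y Z : N π} (g : X ⟶ Y) (h : Y ⟶ Z) :
    (g ≫ h).hom.hom = g.hom.hom ≫ h.hom.hom := rfl

/-- Two arrows of `N` with the same underlying `C`-arrow are equal. [cite: MochizukiFrdII2008, Ex 3.3 (iii) p.29] -/
theorem N.hom_ext' {X Y : N π} {g h : X ⟶ Y} (e : g.hom.hom = h.hom.hom) : g = h :=
  WideSubcategory.hom_ext _ (WideSubcategory.hom_ext _ e)

/-- If an object `X` of `N` is complex for the RC-structure `N → C → D → D₀ → ArchBase` of
Prop. 3.5 (iii), then `π(X_D) = Spec ℂ`. [cite: MochizukiFrdII2008, Def 3.1 (v) p.24] -/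
theorem N.isComplex_of_complexObjects (X : N π)
    (h : RC.complexObjects (N.toC π ⋙ PreFrobenioid.baseFunctor (C.toElem π) ⋙ baseRC π) X) :
    (π.obj X.obj.obj.snd).IsComplex :=
  (D0.isComplex_toArchBase_iff _).mp h

end General

/-! ### The refutation over the Galois-collapsing base -/

/-- **The real unit object of `N` is not an RC-iso-subanchor of `N`** over the Galois-collapsing base
(see the module docstring for the mathematics). [cite: MochizukiFrdII2008, Prop 3.5 (iii) p.34] -/
theorem not_isRCIsoSubanchor_unitObj_N :
    ¬ RC.IsRCIsoSubanchor
        (N.toC D0.collapse ⋙ PreFrobenioid.baseFunctor (C.toElem D0.collapse) ⋙ baseRC D0.collapse)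
        (⟨⟨unitObjOver D0.collapse D0.real⟩⟩ : N D0.collapse) := by
  rintro ⟨B, Γ, f, ⟨B', ⟨hB'c, -⟩, ⟨g⟩⟩, ⟨⟨hinv, huniq⟩, -⟩⟩
  -- `B'` lies over `Spec ℂ`, hence so does `B` (only complex objects map to complex objects)
  have hB'snd : B'.obj.obj.snd = D0.complex := N.isComplex_of_complexObjects D0.collapse B' hB'c
  have hBc : B.obj.obj.fst.base = D0.complex := by
    have k : B.obj.obj.fst.base ⟶ B'.obj.obj.snd :=
      B.obj.obj.iso.hom ≫ D0.collapse.map (g.hom.hom).snd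
    rw [hB'snd] at k
    exact D0.eq_complex_of_hom_complex k
  -- notation for the `C₀`-component `f₀ = (b, d, c)` of `f`
  set fC := f.hom.hom with hfC
  set b := C0.Base fC.fst with hb
  set d := C0.degFr fC.fst with hd
  set c := C0.scalar fC.fst with hc
  have hiso : (unitObjOver D0.collapse D0.real).fst.region.IsIsotropic :=
    AngularRegion.isIsotropic_isotropicOfTip 1
  -- the arrow `ψ₀ = (b, d, i·c) : B₀ → A₀` of `C₀`
  let ψ₀ : B.obj.obj.fst ⟶ (unitObjOver D0.collapse D0.real).fst :=
    { base := b
      degFr := d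
      scalar := unitI * c
      scalar_mem := by
        rw [hBc, D0.scalars_complex]
        exact Subgroup.mem_top _
      mapsTo := by
        have hf := (fC.fst).mapsTo
        intro x hx
        obtain ⟨y, hy, rfl⟩ := Set.mem_smul_set.mp hx
        have hy' : c • y ∈ C0.pullRegion (unitObjOver D0.collapse D0.real).fst b :=
          hf (Set.smul_mem_smul_set hy)
        unfold C0.pullRegion at hy' ⊢
        rw [C0.image_galAct_of_isIsotropic hiso] at hy' ⊢
        rw [C0.mem_carrier_of_isIsotropic hiso] at hy' ⊢
        rw [smul_eq_mul] at hy' ⊢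
        rw [mul_assoc, map_mul, absHom_unitI, one_mul]
        exact hy' }
  -- `ψ₀` has the same `Div` as `f₀` (`|i| = 1`)
  have hdiv : C0.div ψ₀ = C0.div fC.fst := by
    have hr : C0.ratio ψ₀ = C0.ratio fC.fst := by
      unfold C0.ratio
      change _ / (‖((unitI * c : ℂˣ) : ℂ)‖ * _ ^ (d : ℕ)) = _ / (‖(c : ℂ)‖ * _ ^ (d : ℕ))
      rw [Units.val_mul, norm_mul]
      simp [unitI]
    unfold C0.div
    simp only [hr]
  -- … the arrow `ψ_C = (ψ₀, f_D)` of `C`, with the same compatibility square as `f`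
  let ψC : B.obj.obj ⟶ unitObjOver D0.collapse D0.real := ⟨ψ₀, fC.snd, fC.w⟩
  -- … which is an isometry (as `f` is) and linear (as `f` is): an arrow `ψ` of `N`
  have hψiso : PreFrobenioid.isometricMorphisms (C.toElem D0.collapse) ψC := by
    have hfiso : PreFrobenioid.Div (C.toElem D0.collapse) fC = 1 := f.hom.property
    have e1 : PreFrobenioid.Div C0.toElem ψC.fst = PreFrobenioid.Div C0.toElem fC.fst := hdiv
    have key : PreFrobenioid.Div (C.toElem D0.collapse) ψC = PreFrobenioid.Div (C.toElem D0.collapse) fC := by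
      rw [PreFrobenioid.fiberProduct_div, PreFrobenioid.fiberProduct_div, e1]
    change PreFrobenioid.Div (C.toElem D0.collapse) ψC = 1
    rw [key]
    exact hfiso
  have hψlin : PreFrobenioid.linearMorphisms (A.toElem D0.collapse)
      (⟨ψC, hψiso⟩ : B.obj ⟶ (⟨unitObjOver D0.collapse D0.real⟩ : A D0.collapse)) :=
    f.property
  let ψ : B ⟶ (⟨⟨unitObjOver D0.collapse D0.real⟩⟩ : N D0.collapse) := ⟨⟨ψC, hψiso⟩, hψlin⟩
  -- every `γ ∈ Γ` has `C₀`-component over the identity of `D₀` (the image of `Γ` in `D₀` is trivial)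
  have hγb : ∀ γ ∈ Γ, C0.Base (γ.hom.hom.hom).fst = 𝟙 _ := by
    intro γ _
    have w := (γ.hom.hom.hom).w
    rw [D0.collapse_map_endo, Category.comp_id] at w
    exact (cancel_mono B.obj.obj.iso.hom).1 (w.trans (Category.id_comp _).symm)
  -- `ψ` is `Γ`-invariant, exactly as `f` is
  have hψ : ∀ γ ∈ Γ, γ.hom ≫ ψ = ψ := by
    intro γ hγ
    have h1 : γ.hom.hom.hom ≫ fC = fC := by
      rw [hfC, ← N.hom_hom_comp, hinv γ hγ]
    have hfst : (γ.hom.hom.hom).fst ≫ fC.fst = fC.fst := congrArg CFP.Hom.fst h1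
    have hsnd : (γ.hom.hom.hom).snd ≫ fC.snd = fC.snd := congrArg CFP.Hom.snd h1
    have hdeg : C0.degFr (γ.hom.hom.hom).fst * d = d := by
      have h2 := congrArg C0.degFr hfst
      rwa [C0.degFr_comp'] at h2
    have hsc : (C0.Base (γ.hom.hom.hom).fst).act c *
        C0.scalar (γ.hom.hom.hom).fst ^ (d : ℕ) = c := by
      have h2 := congrArg C0.scalar hfst
      rwa [C0.scalar_comp'] at h2
    rw [hγb γ hγ] at hsc
    unfold D0.Hom.act at hsc
    rw [D0.twists_id, D0.galAct_false] at hsc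
    refine N.hom_ext' D0.collapse (CFP.hom_ext (C0.hom_ext ?_ ?_ ?_) hsnd)
    · change C0.Base (γ.hom.hom.hom).fst ≫ b = b
      rw [hγb γ hγ, Category.id_comp]
    · change C0.degFr (γ.hom.hom.hom).fst * d = d
      exact hdeg
    · change (C0.Base (γ.hom.hom.hom).fst).act (unitI * c) *
          C0.scalar (γ.hom.hom.hom).fst ^ (d : ℕ) = unitI * c
      rw [hγb γ hγ]
      unfold D0.Hom.act
      rw [D0.twists_id, D0.galAct_false, mul_assoc, hsc]
  -- but `ψ` does not factor through `f`: the factor would be an endomorphism of the REAL object `A`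
  -- with scalar `i`
  obtain ⟨ψ', hψ', -⟩ := huniq ψ hψ
  have hC : fC ≫ ψ'.hom.hom = ψC := by
    rw [hfC, ← N.hom_hom_comp, hψ']
  have hfst : fC.fst ≫ (ψ'.hom.hom).fst = ψ₀ := congrArg CFP.Hom.fst hC
  have hd1 : C0.degFr (ψ'.hom.hom).fst = 1 := by
    have h2 := congrArg C0.degFr hfst
    rw [C0.degFr_comp'] at h2
    change d * C0.degFr (ψ'.hom.hom).fst = d at h2
    exact mul_left_cancel (h2.trans (mul_one d).symm)
  have hs : C0.scalar (ψ'.hom.hom).fst = unitI := by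
    have h2 := congrArg C0.scalar hfst
    rw [C0.scalar_comp', hd1, PNat.one_coe, pow_one] at h2
    change b.act (C0.scalar (ψ'.hom.hom).fst) * c = unitI * c at h2
    have hbt : D0.Hom.twists b = false := D0.twists_of_real b
    unfold D0.Hom.act at h2
    rw [hbt, D0.galAct_false] at h2
    exact mul_right_cancel h2
  have hmem : C0.scalar (ψ'.hom.hom).fst ∈ D0.scalars D0.real :=
    (ψ'.hom.hom).fst.scalar_mem
  rw [hs] at hmem
  exact unitI_not_mem_scalars_real hmem

/-- **Proposition 3.5 (iii) fails for `N` over `C₀ ×_{D₀} D₀` with the Galois-collapsing functor**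
(finding P35iii-F1; see the module docstring). [cite: MochizukiFrdII2008, Prop 3.5 (iii) p.34] -/
theorem not_prop35iii_N_collapse :
    ¬ Literature.AlgebraicGeometry.Frobenioids.ArchFrd.Prop35iii_N D0.collapse := fun h =>
  not_isRCIsoSubanchor_unitObj_N ((h D0.isOfRCIsoSubanchorType_collapse).isRCIsoSubanchor _)

/-- **Finding P35iii-F1, packaged**: there is a connected, totally epimorphic base `D → D₀` of
RC-iso-subanchor type for which the instance `Prop35iii_N` of [FrdII] Prop. 3.5 (iii) fails.
[cite: MochizukiFrdII2008, Prop 3.5 (iii) p.34] -/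
theorem exists_base_not_prop35iii_N :
    ∃ π : D0 ⥤ D0, IsGraphConnected D0 ∧ IsTotallyEpimorphic D0 ∧
      RC.IsOfRCIsoSubanchorType (baseRC π) ∧
        ¬ Literature.AlgebraicGeometry.Frobenioids.ArchFrd.Prop35iii_N π :=
  ⟨D0.collapse, D0.isGraphConnected, D0.isTotallyEpimorphic, D0.isOfRCIsoSubanchorType_collapse,
    not_prop35iii_N_collapse⟩

end ArchFrd

end

end Literature.AlgebraicGeometry.Frobenioids
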